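import Literature.Analysis.FluidPDE.EulerReynolds
import HarnessLib

/-!
# Dissipative Euler–Reynolds flows (De Lellis–Kwon 2022, Def. 2.1; after Isett 2022)

The relaxation of the incompressible Euler equations *together with the local energy
(in)equality* that drives the convex-integration schemes producing globally dissipative Euler
flows (Isett, Arch. Ration. Mech. Anal. 244 (2022); De Lellis–Kwon, Anal. PDE 15 (2022)). In the
words of De Lellis–Kwon, Def. 2.1: "A tuple of smooth tensors `(v, p, R, κ, φ)` is a *dissipative
Euler–Reynolds flow with global energy loss `E(t)`* if `κ = ½ tr R` and the tuple solves the
Euler–Reynolds system with the Reynolds stress `R + (E/3) Id` and the relaxed local energy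
equality:
  `∂ₜv + ∇·(v ⊗ v) + ∇p = ∇·(R + (E/3) Id) = ∇·R`, `∇·v = 0`,
  `∂ₜ(½|v|²) + ∇·((½|v|² + p) v) = Dₜ(κ + E/2) + ∇·(R v) + ∇·φ`,
where the advective derivative `Dₜ` is `Dₜ = ∂ₜ + (v·∇)` and `(∇·R)ⱼ = ∂ᵢRᵢⱼ`."
When `R`, `κ`, `φ` vanish, `(v, p)` is a smooth Euler flow whose local energy balance has the
time-only defect `E'/2`; the iteration (DLK Prop. 2.3) makes `(R_q, κ_q, φ_q) → 0` uniformly, and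
the uniform limit is a globally dissipative Euler flow (`Torus.IsGloballyDissipativeEulerOn`,
`GloballyDissipativeEuler`; limit step `GloballyDissipativeEulerLimit`).

## Contents

* `Torus.IsDissipativeEulerReynoldsOn S v p R κ φ E` — the notion, for smooth fields on a time set
  `S ⊆ ℝ` (DLK work on enlarged intervals `[0,T] + τ`), in the vocabulary of the tree's
  `Torus.IsEulerReynoldsOn` (`EulerReynolds`): one-sided time derivative `timeDerivWithin S`,
  stress stored by columns (`R t x j = R(t,x) eⱼ`), `(v·∇)v` for `∇·(v ⊗ v)` (equal for
  divergence-free `v`), `R v = ∑ⱼ vⱼ R^{(j)}`, `Dₜ(κ + E/2) = ∂ₜκ + ⟪v, ∇κ⟫ + E'/2`.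
* `Torus.isDissipativeEulerReynoldsOn_zero` — the zero tuple with `E ≡ 0` (start of the
  iteration in DLK §2.2);
* `Torus.IsDissipativeEulerReynoldsOn.smooth_energyDensity`, `….mono_Icc` — API.

## Design notes

* Unlike `Torus.IsEulerReynoldsOn`, the stress is **not** trace free (`κ = ½ tr R` is part of the
  data) and the pressure is not normalised (DLK, Def. 2.1, impose neither).
* `E` is a smooth function of time on `ℝ` (DLK §2.3: "`E` will be assumed to be smooth"); the
  sign condition `E' ≤ 0` and the normalisation `E(0) = 0` of DLK (2.2), (2.9) are *assumptions on
  `E`* made where used, not part of the notion ("not really essential", loc. cit.).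
* Any finite index type `d` (DLK: `d = 3`; the term `E/2 = ½ tr((E/d) Id)` is dimension free).

## References

* C. De Lellis, H. Kwon, *On nonuniqueness of Hölder continuous globally dissipative Euler
  flows*, Anal. PDE 15 (2022) 2003–2059 = arXiv:2006.06482, Def. 2.1, (2.2)–(2.3), §2.2.
  [DelellisKwon2022]
* P. Isett, *Nonuniqueness and existence of continuous, globally dissipative Euler flows*, Arch.
  Ration. Mech. Anal. 244 (2022) = arXiv:1710.11186, §1 (dissipative Euler–Reynolds flows).
-/

noncomputable section

open MeasureTheory Set Filter Function
open scoped InnerProductSpace RealInnerProductSpace ContDiff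

namespace Literature.Analysis.FluidPDE.Torus

variable {d : Type*} [Fintype d] [DecidableEq d]

/-- **Dissipative Euler–Reynolds flows** (De Lellis–Kwon 2022, Def. 2.1; Isett 2022, §1). A tuple
of fields `(v, p, R, κ, φ)` — velocity, pressure, stress (stored by columns, `R t x j ∈ ℝ^d`),
unsolved flux density `κ` and unsolved flux current `φ` — jointly `C^∞` on `S × T^d`, together
with a smooth global energy loss `E : ℝ → ℝ`, such that `κ = ½ tr R`, `R` is symmetric, and
pointwise on `S × T^d`
  `∂ₜv + (v·∇)v + ∇p = div R`, `div v = 0`,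
  `∂ₜ(½|v|²) + div((½|v|² + p) v) = ∂ₜκ + ⟪v, ∇κ⟫ + E'/2 + div(R v) + div φ`
(the last line is DLK's `Dₜ(κ + E/2) + ∇·(R v) + ∇·φ` with `Dₜ = ∂ₜ + v·∇`, `E` depending on
time only; `R v = ∑ⱼ vⱼ R^{(j)}`; for divergence-free `v`, `(v·∇)v = ∇·(v ⊗ v)`). The time
derivative is the one-sided `Torus.timeDerivWithin S` (convention of `Torus.IsEulerReynoldsOn`).
When `R`, `κ`, `φ` vanish identically, `(v, p)` is a classical Euler flow whose local energy
balance has the defect `E'(t)/2`. [cite: DelellisKwon2022, Def. 2.1] -/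
structure IsDissipativeEulerReynoldsOn (S : Set ℝ) (v : ℝ → UnitAddTorus d → EuclideanSpace ℝ d)
    (p : ℝ → UnitAddTorus d → ℝ) (R : ℝ → UnitAddTorus d → d → EuclideanSpace ℝ d)
    (κ : ℝ → UnitAddTorus d → ℝ) (φ : ℝ → UnitAddTorus d → EuclideanSpace ℝ d) (E : ℝ → ℝ) :
    Prop where
  /-- The velocity is jointly smooth on `S × T^d`. -/
  smooth_velocity : FunctionSpaces.Torus.IsSmoothSpaceTimeOn S v
  /-- The pressure is jointly smooth on `S × T^d`. -/
  smooth_pressure : FunctionSpaces.Torus.IsSmoothSpaceTimeOn S p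
  /-- The stress is jointly smooth on `S × T^d`. -/
  smooth_stress : FunctionSpaces.Torus.IsSmoothSpaceTimeOn S R
  /-- The unsolved flux density `κ` is jointly smooth on `S × T^d`. -/
  smooth_kappa : FunctionSpaces.Torus.IsSmoothSpaceTimeOn S κ
  /-- The unsolved flux current `φ` is jointly smooth on `S × T^d`. -/
  smooth_current : FunctionSpaces.Torus.IsSmoothSpaceTimeOn S φ
  /-- The global energy loss `E` is a smooth function of time. -/
  smooth_energyLoss : ContDiff ℝ ∞ E
  /-- The momentum equation `∂ₜv + (v·∇)v + ∇p = div R` holds pointwise on `S × T^d`. -/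
  momentum : ∀ t ∈ S, ∀ x,
    FunctionSpaces.Torus.timeDerivWithin S v t x + FunctionSpaces.Torus.convect (v t) (v t) x +
      FunctionSpaces.Torus.gradient (p t) x = tensorDivergence (R t) x
  /-- Incompressibility `div v(t) = 0` for `t ∈ S`. -/
  divFree : ∀ t ∈ S, FunctionSpaces.Torus.IsDivFree (v t)
  /-- The stress is symmetric. -/
  symm : ∀ t ∈ S, ∀ x, ∀ i j : d, R t x i j = R t x j i
  /-- The unsolved flux density is half the trace of the stress, `κ = ½ tr R`. -/
  kappa_eq : ∀ t ∈ S, ∀ x, κ t x = 2⁻¹ * ∑ i, R t x i i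
  /-- The relaxed local energy equality
  `∂ₜ(½|v|²) + div((½|v|² + p) v) = ∂ₜκ + ⟪v, ∇κ⟫ + E'/2 + div(R v) + div φ`, pointwise on
  `S × T^d`. -/
  localEnergy : ∀ t ∈ S, ∀ x,
    FunctionSpaces.Torus.timeDerivWithin S (fun s y => 2⁻¹ * ‖v s y‖ ^ 2) t x +
        FunctionSpaces.Torus.divergence (fun y => (2⁻¹ * ‖v t y‖ ^ 2 + p t y) • v t y) x =
      FunctionSpaces.Torus.timeDerivWithin S κ t x + ⟪v t x, FunctionSpaces.Torus.gradient (κ t) x⟫_ℝ +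
        2⁻¹ * deriv E t + FunctionSpaces.Torus.divergence (fun y => ∑ j, v t y j • R t y j) x +
        FunctionSpaces.Torus.divergence (φ t) x

/-- The zero tuple `(v, p, R, κ, φ) = 0` with energy loss `E ≡ 0` is a dissipative Euler–Reynolds
flow on every time set (the start of the iteration in De Lellis–Kwon 2022, §2.2:
"we take `E ≡ 0` and we start with `(v₀, p₀, R₀, κ₀, φ₀) = (0,0,0,0,0)`"). [cite: DelellisKwon2022, §2.2] -/
theorem isDissipativeEulerReynoldsOn_zero (S : Set ℝ) :
    IsDissipativeEulerReynoldsOn (d := d) S (fun _ _ => 0) (fun _ _ => 0) (fun _ _ _ => 0)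
      (fun _ _ => 0) (fun _ _ => 0) (fun _ => 0) where
  smooth_velocity := contDiffOn_const
  smooth_pressure := contDiffOn_const
  smooth_stress := contDiffOn_const
  smooth_kappa := contDiffOn_const
  smooth_current := contDiffOn_const
  smooth_energyLoss := contDiff_const
  momentum t _ x := by simp
  divFree t _ x := by simp
  symm _ _ _ _ _ := rfl
  kappa_eq _ _ _ := by simp
  localEnergy t _ x := by simp

namespace IsDissipativeEulerReynoldsOn

variable {S : Set ℝ} {T : ℝ} {v : ℝ → UnitAddTorus d → EuclideanSpace ℝ d}
  {p : ℝ → UnitAddTorus d → ℝ} {R : ℝ → UnitAddTorus d → d → EuclideanSpace ℝ d}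
  {κ : ℝ → UnitAddTorus d → ℝ} {φ : ℝ → UnitAddTorus d → EuclideanSpace ℝ d} {E : ℝ → ℝ}

/-- The kinetic energy density `½|v|²` of a dissipative Euler–Reynolds flow is jointly smooth. [folklore] -/
theorem smooth_energyDensity (h : IsDissipativeEulerReynoldsOn S v p R κ φ E) :
    FunctionSpaces.Torus.IsSmoothSpaceTimeOn S (fun s y => 2⁻¹ * ‖v s y‖ ^ 2) :=
  contDiffOn_const.mul (h.smooth_velocity.norm_sq ℝ)

/-- The field `R v = ∑ⱼ vⱼ R^{(j)}` of a dissipative Euler–Reynolds flow is jointly smooth. [folklore] -/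
theorem smooth_stressVelocity (h : IsDissipativeEulerReynoldsOn S v p R κ φ E) :
    FunctionSpaces.Torus.IsSmoothSpaceTimeOn S (fun t x => ∑ j, v t x j • R t x j) :=
  FunctionSpaces.Torus.IsSmoothSpaceTimeOn.sum fun j _ =>
    (h.smooth_velocity.apply j).smul (h.smooth_stress.column j)

/-- The energy loss of a dissipative Euler–Reynolds flow is `C¹` (it is smooth). [folklore] -/
theorem contDiff_one_energyLoss (h : IsDissipativeEulerReynoldsOn S v p R κ φ E) :
    ContDiff ℝ 1 E :=
  h.smooth_energyLoss.of_le (by simp)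

/-- Restriction in time: a dissipative Euler–Reynolds flow on `S` is one on every interval
`[0, T] ⊆ S`, `0 < T` (the one-sided time derivatives within `[0, T]` and within `S` of the
smooth fields agree on `[0, T]`). DLK work on enlarged intervals `[0,T] + τ_q ⊇ [0,T]`. [folklore] -/
theorem mono_Icc (h : IsDissipativeEulerReynoldsOn S v p R κ φ E) (hS : Icc 0 T ⊆ S)
    (hT : 0 < T) : IsDissipativeEulerReynoldsOn (Icc 0 T) v p R κ φ E where
  smooth_velocity := h.smooth_velocity.mono hS
  smooth_pressure := h.smooth_pressure.mono hS
  smooth_stress := h.smooth_stress.mono hS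
  smooth_kappa := h.smooth_kappa.mono hS
  smooth_current := h.smooth_current.mono hS
  smooth_energyLoss := h.smooth_energyLoss
  momentum t ht x := by
    have h1 : FunctionSpaces.Torus.timeDerivWithin (Icc 0 T) v t x =
        FunctionSpaces.Torus.timeDerivWithin S v t x :=
      ((h.smooth_velocity.hasDerivWithinAt_slice (hS ht) x).mono hS).derivWithin
        (uniqueDiffOn_Icc hT t ht)
    rw [h1]
    exact h.momentum t (hS ht) x
  divFree t ht := h.divFree t (hS ht)
  symm t ht := h.symm t (hS ht)
  kappa_eq t ht := h.kappa_eq t (hS ht)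
  localEnergy t ht x := by
    have h1 : FunctionSpaces.Torus.timeDerivWithin (Icc 0 T) (fun s y => 2⁻¹ * ‖v s y‖ ^ 2) t x =
        FunctionSpaces.Torus.timeDerivWithin S (fun s y => 2⁻¹ * ‖v s y‖ ^ 2) t x :=
      ((h.smooth_energyDensity.hasDerivWithinAt_slice (hS ht) x).mono hS).derivWithin
        (uniqueDiffOn_Icc hT t ht)
    have h2 : FunctionSpaces.Torus.timeDerivWithin (Icc 0 T) κ t x =
        FunctionSpaces.Torus.timeDerivWithin S κ t x :=
      ((h.smooth_kappa.hasDerivWithinAt_slice (hS ht) x).mono hS).derivWithin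
        (uniqueDiffOn_Icc hT t ht)
    rw [h1, h2]
    exact h.localEnergy t (hS ht) x

/-- Continuity of the space–time lifts of all fields of a dissipative Euler–Reynolds flow on
`S × ℝ^d` (they are smooth there). [folklore] -/
theorem continuousOn_stLift (h : IsDissipativeEulerReynoldsOn S v p R κ φ E) :
    ContinuousOn (FunctionSpaces.Torus.stLift v) (S ×ˢ univ) ∧
      ContinuousOn (FunctionSpaces.Torus.stLift p) (S ×ˢ univ) ∧
      ContinuousOn (FunctionSpaces.Torus.stLift R) (S ×ˢ univ) ∧
      ContinuousOn (FunctionSpaces.Torus.stLift κ) (S ×ˢ univ) ∧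
      ContinuousOn (FunctionSpaces.Torus.stLift φ) (S ×ˢ univ) :=
  ⟨h.smooth_velocity.continuousOn_stLift, h.smooth_pressure.continuousOn_stLift,
    h.smooth_stress.continuousOn_stLift, h.smooth_kappa.continuousOn_stLift,
    h.smooth_current.continuousOn_stLift⟩

/-- The velocity of a dissipative Euler–Reynolds flow is weakly divergence free at every time of
`S` (classical ⇒ weak incompressibility on the torus). [folklore] -/
theorem isWeaklyDivFree (h : IsDissipativeEulerReynoldsOn S v p R κ φ E) {t : ℝ} (ht : t ∈ S) :
    FunctionSpaces.Torus.IsWeaklyDivFree (v t) :=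
  (h.divFree t ht).isWeaklyDivFree_holds (h.smooth_velocity.isSmooth_slice ht)

end IsDissipativeEulerReynoldsOn

end Literature.Analysis.FluidPDE.Torus
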